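import Mathlib.MeasureTheory.Integral.IntervalIntegral.Basic
import Mathlib.MeasureTheory.Integral.Bochner.Set
import Mathlib.Analysis.MeanInequalitiesPow
import Mathlib.Algebra.Order.Chebyshev
import Mathlib.Algebra.Order.Floor.Defs
import HarnessLib

/-!
# Time increments and cell averages: an `L³(0,T)` bound for functions of bounded variation type

Analysis/FunctionSpaces support file (theorem-only). The elementary time-direction estimate behind
Aubin–Lions–Simon compactness with a merely `L¹(0,T)` bound on time derivatives (Simon 1987, §8,
Thm. 5 / Cor. 4: "`∂F/∂t` bounded in `L¹(0,T;Y)`"; Lions 1969, Ch. 1 Thm. 5.1), in the quantitative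
form used on the Fourier side: if `F : (0,T) → E` has increments controlled by a nonnegative
integrable rate, `‖F(t) - F(s)‖ ≤ ∫ₛᵗ g` (`s ≤ t`), then for every number `L + 1` of cells
`I_l = (l h, (l+1) h)`, `h = T/(L+1)`,

  `∫₀ᵀ ‖F‖³ ≤ 4 h⁻² ∑_l ‖∫_{I_l} F‖³ + 4 h (∫₀ᵀ g)³`

(`lintegral_enorm_pow_three_le_of_increments`): inside a cell `F` differs from its average by at
most `Γ_l = ∫_{I_l} g`, and `∑_l Γ_l³ ≤ (∑_l Γ_l)³ ≤ (∫₀ᵀ g)³`. Letting first `L → ∞` (the second term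
is `O(h)`) and then the finitely many cell averages converge is how strong `L³(0,T)` convergence of
the coefficient functions is obtained from convergence of their cell averages, without any
equi-integrability of the rates `g` (Simon 1987, §8, proof of Thm. 5).

Also the elementary power inequalities used with it: `∑ aᵢ³ ≤ (∑ aᵢ)³` in `ℝ≥0∞` and the power
mean `(∑_{i∈s} aᵢ)³ ≤ |s|² ∑ aᵢ³` in `ℝ` (the convexity bound `(a + b)³ ≤ 4 a³ + 4 b³` is kept
file-private).

## Mathlib search

Mathlib (this pin): `ENNReal.rpow_add_le_mul_rpow_add_rpow`, `pow_sum_div_card_le_sum_pow`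
(Chebyshev file), `norm_setIntegral_le_of_norm_le_const`, `setIntegral_mono_set`,
`integral_biUnion_finset`, `lintegral_indicator_const`, `Nat.floor`; no Aubin–Lions / Simon
compactness lemma and no Bochner-space `W^{1,1}(0,T;Y)` (searched `Aubin`, `Simon`, `compact`
+ `Lp` + `time`: none).

## References

* J. Simon, *Compact sets in the space `L^p(0,T;B)`*, Ann. Mat. Pura Appl. (4) 146 (1987),
  65–96, §8, Thm. 5 and Cor. 4. [Simon1986]
* J.-L. Lions, *Quelques méthodes de résolution des problèmes aux limites non linéaires* (1969),
  Ch. 1, Thm. 5.1 (Aubin–Lions). [folklore]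
-/

noncomputable section

open MeasureTheory Set Filter Function
open scoped ENNReal NNReal Topology

namespace Literature.Analysis.FunctionSpaces

/-! ## Elementary power inequalities -/

section Elementary

/-- `(a + b)³ ≤ 4 a³ + 4 b³` in `ℝ≥0∞` (convexity of the cube,
`ENNReal.rpow_add_le_mul_rpow_add_rpow`). File-private: the same inequality is proved, equally
privately in spirit, in unrelated `FluidPDE` files (`TaoY6ChainBound`, `DyadicChaining`) which a
`FunctionSpaces` file does not import. [folklore] -/
private theorem ennreal_add_pow_three_le (a b : ℝ≥0∞) : (a + b) ^ 3 ≤ 4 * a ^ 3 + 4 * b ^ 3 := by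
  have h := ENNReal.rpow_add_le_mul_rpow_add_rpow a b (by norm_num : (1 : ℝ) ≤ 3)
  have e : ∀ x : ℝ≥0∞, x ^ (3 : ℝ) = x ^ 3 := fun x => by
    rw [show (3 : ℝ) = ((3 : ℕ) : ℝ) by norm_num, ENNReal.rpow_natCast]
  have e2 : (2 : ℝ≥0∞) ^ ((3 : ℝ) - 1) = 4 := by
    rw [show (3 : ℝ) - 1 = ((2 : ℕ) : ℝ) by norm_num, ENNReal.rpow_natCast]
    norm_num
  rw [e, e, e, e2, mul_add] at h
  exact h

/-- Superadditivity of cubes: `∑ᵢ aᵢ³ ≤ (∑ᵢ aᵢ)³` in `ℝ≥0∞` (`aᵢ³ = aᵢ · aᵢ² ≤ aᵢ · (∑ a)²`). [folklore] -/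
theorem ennreal_sum_pow_three_le_pow_sum {ι : Type*} (s : Finset ι) (a : ι → ℝ≥0∞) :
    ∑ i ∈ s, a i ^ 3 ≤ (∑ i ∈ s, a i) ^ 3 := by
  calc ∑ i ∈ s, a i ^ 3 = ∑ i ∈ s, a i * a i ^ 2 := by
        refine Finset.sum_congr rfl fun i _ => ?_
        ring
    _ ≤ ∑ i ∈ s, a i * (∑ j ∈ s, a j) ^ 2 := by
        refine Finset.sum_le_sum fun i hi => ?_
        gcongr
        exact Finset.single_le_sum (fun j _ => zero_le) hi
    _ = (∑ i ∈ s, a i) ^ 3 := by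
        rw [← Finset.sum_mul]
        ring

/-- Power mean for cubes: `(∑_{i∈s} aᵢ)³ ≤ |s|² ∑_{i∈s} aᵢ³` for nonnegative reals (Mathlib's
`pow_sum_div_card_le_sum_pow`). [folklore] -/
theorem real_pow_three_sum_le_card_sq_mul_sum {ι : Type*} (s : Finset ι) {a : ι → ℝ}
    (ha : ∀ i ∈ s, 0 ≤ a i) :
    (∑ i ∈ s, a i) ^ 3 ≤ (s.card : ℝ) ^ 2 * ∑ i ∈ s, a i ^ 3 := by
  rcases s.eq_empty_or_nonempty with rfl | hne
  · simp
  have hc : (0 : ℝ) < s.card := by exact_mod_cast hne.card_pos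
  have h := pow_sum_div_card_le_sum_pow (f := a) (s := s) ha 2
  rw [div_le_iff₀ (by positivity)] at h
  norm_num at h
  calc (∑ i ∈ s, a i) ^ 3 ≤ (∑ i ∈ s, a i ^ 3) * (s.card : ℝ) ^ 2 := h
    _ = (s.card : ℝ) ^ 2 * ∑ i ∈ s, a i ^ 3 := mul_comm _ _

end Elementary

/-! ## Cells of a uniform partition of `(0, T)` -/

section Cells

variable {T h : ℝ} {n : ℕ}

/-- The cell `(l h, (l+1) h)` lies in `(0, T)` when `l < n` and `n h = T`, `h > 0`. [folklore] -/
theorem Ioo_cell_subset (hh : 0 < h) (hnh : (n : ℝ) * h = T) {l : ℕ} (hl : l < n) :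
    Ioo ((l : ℝ) * h) ((l + 1 : ℝ) * h) ⊆ Ioo 0 T := by
  intro x hx
  refine ⟨lt_of_le_of_lt (by positivity) hx.1, lt_of_lt_of_le hx.2 ?_⟩
  rw [← hnh]
  have : (l + 1 : ℝ) ≤ n := by exact_mod_cast hl
  exact mul_le_mul_of_nonneg_right this hh.le

/-- Distinct cells are disjoint. [folklore] -/
theorem pairwise_disjoint_Ioo_cell (hh : 0 < h) :
    Pairwise (Disjoint on fun l : ℕ => Ioo ((l : ℝ) * h) ((l + 1 : ℝ) * h)) := by
  intro l₁ l₂ hne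
  refine Set.disjoint_left.2 fun x hx₁ hx₂ => hne ?_
  have h1 : (l₁ : ℝ) < l₂ + 1 := by
    have := hx₁.1.trans hx₂.2
    exact lt_of_mul_lt_mul_right this hh.le
  have h2 : (l₂ : ℝ) < l₁ + 1 := by
    have := hx₂.1.trans hx₁.2
    exact lt_of_mul_lt_mul_right this hh.le
  have h1' : l₁ < l₂ + 1 := by exact_mod_cast h1
  have h2' : l₂ < l₁ + 1 := by exact_mod_cast h2
  omega

/-- **Cells cover `(0, T)` up to the partition points**: if `0 < t < T = n h` and `t` is not of
the form `l h` (`l ≤ n`), then `t` lies in the cell of index `⌊t/h⌋ < n`. [folklore] -/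
theorem exists_mem_Ioo_cell (hh : 0 < h) (hnh : (n : ℝ) * h = T) {t : ℝ} (ht : t ∈ Ioo 0 T)
    (hP : ∀ l : ℕ, l ≤ n → t ≠ (l : ℝ) * h) :
    ∃ l : ℕ, l < n ∧ t ∈ Ioo ((l : ℝ) * h) ((l + 1 : ℝ) * h) := by
  set l := ⌊t / h⌋₊ with hl
  have ht0 : 0 ≤ t / h := div_nonneg ht.1.le hh.le
  have hfl : (l : ℝ) ≤ t / h := Nat.floor_le ht0
  have hlt : t / h < l + 1 := Nat.lt_floor_add_one (t / h)
  have htn : t / h < n := by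
    rw [div_lt_iff₀ hh, hnh]
    exact ht.2
  have hln : l < n := by
    have : (l : ℝ) < n := hfl.trans_lt htn
    exact_mod_cast this
  refine ⟨l, hln, ?_, ?_⟩
  · have hle : (l : ℝ) * h ≤ t := by rwa [le_div_iff₀ hh] at hfl
    exact lt_of_le_of_ne hle (fun heq => hP l hln.le heq.symm)
  · rwa [div_lt_iff₀ hh] at hlt

end Cells

/-! ## The `L³` bound from increments and cell averages -/

section Increments

variable {E : Type*} [NormedAddCommGroup E] [NormedSpace ℝ E] [CompleteSpace E]

/-- Inside a cell `I ⊆ (0,T)` on which the increments of `F` are at most `Γ`, the values of `F`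
are within `Γ` of the cell average: `h ‖F t‖ ≤ ‖∫_I F‖ + h Γ` (`h = |I|`, `t ∈ I`). [folklore] -/
theorem mul_norm_le_norm_setIntegral_add {F : ℝ → E} {a b Γ : ℝ} (hab : a < b)
    (hF : IntegrableOn F (Ioo a b)) (hcell : ∀ s ∈ Ioo a b, ∀ t ∈ Ioo a b, ‖F t - F s‖ ≤ Γ)
    {t : ℝ} (ht : t ∈ Ioo a b) :
    (b - a) * ‖F t‖ ≤ ‖∫ s in Ioo a b, F s‖ + (b - a) * Γ := by
  have hvol : volume (Ioo a b) = ENNReal.ofReal (b - a) := Real.volume_Ioo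
  have hvol' : volume.real (Ioo a b) = b - a := by
    rw [measureReal_def, hvol, ENNReal.toReal_ofReal (sub_pos.2 hab).le]
  have hfin : volume (Ioo a b) < ∞ := by rw [hvol]; exact ENNReal.ofReal_lt_top
  have hc : IntegrableOn (fun _ : ℝ => F t) (Ioo a b) := integrableOn_const hfin.ne
  have e1 : ∫ s in Ioo a b, (F t - F s) = (b - a) • F t - ∫ s in Ioo a b, F s := by
    rw [integral_sub hc hF, setIntegral_const, hvol']
  have e2 : ‖∫ s in Ioo a b, (F t - F s)‖ ≤ Γ * (b - a) := by
    have := norm_setIntegral_le_of_norm_le_const hfin (fun s hs => hcell s hs t ht)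
    rwa [hvol'] at this
  have e3 : ‖(b - a) • F t‖ ≤ ‖∫ s in Ioo a b, F s‖ + ‖(b - a) • F t - ∫ s in Ioo a b, F s‖ :=
    norm_le_insert' _ _
  rw [norm_smul, Real.norm_eq_abs, abs_of_pos (sub_pos.2 hab)] at e3
  rw [← e1] at e3
  linarith [e2, e3]

/-- **`L³(0,T)` bound from increments and cell averages** (the time-direction step of Simon 1987,
§8, Thm. 5, made quantitative). Let `F : ℝ → E` and `g ≥ 0` be integrable on `(0,T)` with
`‖F(t) - F(s)‖ ≤ ∫ₛᵗ g` for `s ≤ t` in `(0,T)`. Then for every `L`, with `h = T/(L+1)` and the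
cells `I_l = (l h, (l+1) h)`, `l = 0, …, L`:
`∫₀ᵀ ‖F‖³ ≤ 4 h⁻² ∑_l ‖∫_{I_l} F‖³ + 4 h (∫₀ᵀ g)³`
(in the cell `I_l`, `‖F(t)‖ ≤ h⁻¹‖∫_{I_l} F‖ + Γ_l` with `Γ_l = ∫_{I_l} g`, so
`∫_{I_l} ‖F‖³ ≤ 4 h⁻² ‖∫_{I_l} F‖³ + 4 h Γ_l³`, and `∑_l Γ_l³ ≤ (∑_l Γ_l)³ ≤ (∫₀ᵀ g)³`). [cite: Simon1986, §8 Thm. 5] -/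
theorem lintegral_enorm_pow_three_le_of_increments {T : ℝ} (hT : 0 < T) {F : ℝ → E} {g : ℝ → ℝ}
    (hF : IntegrableOn F (Ioo 0 T)) (hg : IntegrableOn g (Ioo 0 T))
    (hg0 : ∀ τ ∈ Ioo 0 T, 0 ≤ g τ)
    (hinc : ∀ ⦃s t : ℝ⦄, s ∈ Ioo 0 T → t ∈ Ioo 0 T → s ≤ t → ‖F t - F s‖ ≤ ∫ τ in s..t, g τ)
    (L : ℕ) :
    ∫⁻ t in Ioo 0 T, ‖F t‖ₑ ^ 3 ≤
      4 * ENNReal.ofReal ((L + 1 : ℝ) / T) ^ 2 *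
          ∑ l ∈ Finset.range (L + 1),
            ‖∫ t in Ioo ((l : ℝ) * (T / (L + 1))) ((l + 1 : ℝ) * (T / (L + 1))), F t‖ₑ ^ 3 +
        4 * ENNReal.ofReal (T / (L + 1)) * ENNReal.ofReal (∫ τ in Ioo 0 T, g τ) ^ 3 := by
  -- the partition
  set n : ℕ := L + 1 with hn
  have hnR : (n : ℝ) = L + 1 := by rw [hn]; push_cast; ring
  have hn0 : (0 : ℝ) < n := by rw [hnR]; positivity
  set h : ℝ := T / (L + 1) with hh
  have hh' : h = T / n := by rw [hh, hnR]
  have hh0 : 0 < h := by rw [hh]; positivity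
  have hnh : (n : ℝ) * h = T := by rw [hh']; field_simp
  have hinvh : (L + 1 : ℝ) / T = h⁻¹ := by rw [hh, inv_div]
  set I : ℕ → Set ℝ := fun l => Ioo ((l : ℝ) * h) ((l + 1 : ℝ) * h) with hI
  have hIsub : ∀ l, l < n → I l ⊆ Ioo 0 T := fun l hl => Ioo_cell_subset hh0 hnh hl
  have hIlt : ∀ l : ℕ, (l : ℝ) * h < (l + 1 : ℝ) * h := fun l =>
    mul_lt_mul_of_pos_right (by linarith) hh0
  have hIvol : ∀ l, volume (I l) = ENNReal.ofReal h := by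
    intro l
    rw [hI]
    simp only [Real.volume_Ioo]
    congr 1
    ring
  set A : ℕ → E := fun l => ∫ t in I l, F t with hA
  set Γ : ℕ → ℝ := fun l => ∫ t in I l, g t with hΓ
  have hΓ0 : ∀ l, l < n → 0 ≤ Γ l := fun l hl =>
    setIntegral_nonneg measurableSet_Ioo fun t ht => hg0 t (hIsub l hl ht)
  -- increments inside a cell are at most `Γ l`
  have hcell : ∀ l, l < n → ∀ s ∈ I l, ∀ t ∈ I l, ‖F t - F s‖ ≤ Γ l := by
    intro l hl
    have hgI : IntegrableOn g (I l) := hg.mono_set (hIsub l hl)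
    have key : ∀ s ∈ I l, ∀ t ∈ I l, s ≤ t → ‖F t - F s‖ ≤ Γ l := by
      intro s hs t ht hst
      refine (hinc (hIsub l hl hs) (hIsub l hl ht) hst).trans ?_
      rw [intervalIntegral.integral_of_le hst]
      refine setIntegral_mono_set hgI ?_ (Eventually.of_forall fun x hx => ?_)
      · exact (ae_restrict_iff' measurableSet_Ioo).2
          (Eventually.of_forall fun x hx => hg0 x (hIsub l hl hx))
      · exact ⟨hs.1.trans hx.1, lt_of_le_of_lt hx.2 ht.2⟩
    intro s hs t ht
    rcases le_total s t with hst | hts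
    · exact key s hs t ht hst
    · rw [norm_sub_rev]
      exact key t ht s hs hts
  -- pointwise bound inside a cell, cubed, in `ℝ≥0∞`
  set c : ℕ → ℝ≥0∞ := fun l =>
    4 * (‖A l‖ₑ * (ENNReal.ofReal h)⁻¹) ^ 3 + 4 * ENNReal.ofReal (Γ l) ^ 3 with hc
  have hpt : ∀ l, l < n → ∀ t ∈ I l, ‖F t‖ₑ ^ 3 ≤ c l := by
    intro l hl t ht
    have h1 := mul_norm_le_norm_setIntegral_add (hIlt l) (hF.mono_set (hIsub l hl)) (hcell l hl) ht
    have hba : ((l + 1 : ℝ) * h) - (l : ℝ) * h = h := by ring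
    rw [hba] at h1
    have h2 : ‖F t‖ ≤ ‖A l‖ * h⁻¹ + Γ l := by
      have h1' : h * ‖F t‖ ≤ ‖A l‖ + h * Γ l := h1
      calc ‖F t‖ = (h * ‖F t‖) * h⁻¹ := by field_simp
        _ ≤ (‖A l‖ + h * Γ l) * h⁻¹ := mul_le_mul_of_nonneg_right h1' (inv_nonneg.2 hh0.le)
        _ = ‖A l‖ * h⁻¹ + Γ l := by field_simp
    have h3 : ‖F t‖ₑ ≤ ‖A l‖ₑ * (ENNReal.ofReal h)⁻¹ + ENNReal.ofReal (Γ l) := by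
      rw [← ofReal_norm, ← ofReal_norm, ← ENNReal.ofReal_inv_of_pos hh0,
        ← ENNReal.ofReal_mul (norm_nonneg _),
        ← ENNReal.ofReal_add (mul_nonneg (norm_nonneg _) (inv_nonneg.2 hh0.le)) (hΓ0 l hl)]
      exact ENNReal.ofReal_le_ofReal h2
    calc ‖F t‖ₑ ^ 3 ≤ (‖A l‖ₑ * (ENNReal.ofReal h)⁻¹ + ENNReal.ofReal (Γ l)) ^ 3 := by gcongr
      _ ≤ c l := ennreal_add_pow_three_le _ _
  -- the partition points form a null set, off which every `t ∈ (0,T)` lies in a cell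
  set P : Set ℝ := (fun l : ℕ => (l : ℝ) * h) '' (Finset.range (n + 1) : Set ℕ) with hP
  have hPfin : P.Finite := (Finset.finite_toSet _).image _
  have hae : ∀ᵐ t ∂(volume.restrict (Ioo 0 T)),
      ‖F t‖ₑ ^ 3 ≤ ∑ l ∈ Finset.range n, (I l).indicator (fun _ => c l) t := by
    have hP0 : ∀ᵐ t ∂(volume : Measure ℝ), t ∉ P :=
      measure_eq_zero_iff_ae_notMem.1 (hPfin.measure_zero volume)
    filter_upwards [ae_restrict_of_ae hP0, ae_restrict_mem measurableSet_Ioo] with t htP ht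
    have hP' : ∀ l : ℕ, l ≤ n → t ≠ (l : ℝ) * h := by
      intro l hl heq
      exact htP ⟨l, by simpa [Nat.lt_succ_iff] using hl, heq.symm⟩
    obtain ⟨l₀, hl₀, htl₀⟩ := exists_mem_Ioo_cell hh0 hnh ht hP'
    calc ‖F t‖ₑ ^ 3 ≤ c l₀ := hpt l₀ hl₀ t htl₀
      _ = (I l₀).indicator (fun _ => c l₀) t := by rw [indicator_of_mem htl₀]
      _ ≤ ∑ l ∈ Finset.range n, (I l).indicator (fun _ => c l) t :=
          Finset.single_le_sum (f := fun l => (I l).indicator (fun _ => c l) t)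
            (fun l _ => zero_le) (Finset.mem_range.2 hl₀)
  -- integrate
  have hint : ∫⁻ t in Ioo 0 T, ‖F t‖ₑ ^ 3 ≤ ∑ l ∈ Finset.range n, c l * ENNReal.ofReal h := by
    refine (lintegral_mono_ae hae).trans ?_
    rw [lintegral_finsetSum _ fun l _ => (measurable_const.indicator measurableSet_Ioo)]
    refine Finset.sum_le_sum fun l _ => ?_
    rw [lintegral_indicator_const measurableSet_Ioo, ← hIvol l]
    gcongr
    exact Measure.restrict_le_self
  -- the sum of the rates over the cells is at most `∫₀ᵀ g`
  have hΓsum : ∑ l ∈ Finset.range n, Γ l ≤ ∫ τ in Ioo 0 T, g τ := by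
    rw [hΓ, ← integral_biUnion_finset (Finset.range n) (fun l _ => measurableSet_Ioo)
      (fun l₁ _ l₂ _ hne => pairwise_disjoint_Ioo_cell hh0 hne)
      (fun l hl => hg.mono_set (hIsub l (Finset.mem_range.1 hl)))]
    refine setIntegral_mono_set hg ?_ (Eventually.of_forall fun x hx => ?_)
    · exact (ae_restrict_iff' measurableSet_Ioo).2 (Eventually.of_forall fun x hx => hg0 x hx)
    · obtain ⟨l, hl, hxl⟩ := Set.mem_iUnion₂.1 hx
      have hl' : l < n := by simpa using hl
      exact hIsub l hl' hxl
  have hΓsum' : ∑ l ∈ Finset.range n, ENNReal.ofReal (Γ l) ≤ ENNReal.ofReal (∫ τ in Ioo 0 T, g τ) := by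
    rw [← ENNReal.ofReal_sum_of_nonneg fun l hl => hΓ0 l (Finset.mem_range.1 hl)]
    exact ENNReal.ofReal_le_ofReal hΓsum
  -- assemble
  have hhinv : ENNReal.ofReal h * (ENNReal.ofReal h)⁻¹ = 1 :=
    ENNReal.mul_inv_cancel (ENNReal.ofReal_pos.2 hh0).ne' ENNReal.ofReal_ne_top
  calc ∫⁻ t in Ioo 0 T, ‖F t‖ₑ ^ 3
      ≤ ∑ l ∈ Finset.range n, c l * ENNReal.ofReal h := hint
    _ = 4 * (ENNReal.ofReal h)⁻¹ ^ 2 * ∑ l ∈ Finset.range n, ‖A l‖ₑ ^ 3 +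
          4 * ENNReal.ofReal h * ∑ l ∈ Finset.range n, ENNReal.ofReal (Γ l) ^ 3 := by
        simp only [hc, add_mul, Finset.sum_add_distrib, Finset.mul_sum]
        congr 1
        · refine Finset.sum_congr rfl fun l _ => ?_
          calc 4 * (‖A l‖ₑ * (ENNReal.ofReal h)⁻¹) ^ 3 * ENNReal.ofReal h
              = 4 * (ENNReal.ofReal h)⁻¹ ^ 2 * ‖A l‖ₑ ^ 3 *
                  (ENNReal.ofReal h * (ENNReal.ofReal h)⁻¹) := by ring
            _ = 4 * (ENNReal.ofReal h)⁻¹ ^ 2 * ‖A l‖ₑ ^ 3 := by rw [hhinv, mul_one]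
        · refine Finset.sum_congr rfl fun l _ => ?_
          ring
    _ ≤ 4 * (ENNReal.ofReal h)⁻¹ ^ 2 * ∑ l ∈ Finset.range n, ‖A l‖ₑ ^ 3 +
          4 * ENNReal.ofReal h * ENNReal.ofReal (∫ τ in Ioo 0 T, g τ) ^ 3 := by
        gcongr 4 * (ENNReal.ofReal h)⁻¹ ^ 2 * _ + 4 * ENNReal.ofReal h * ?_
        exact (ennreal_sum_pow_three_le_pow_sum _ _).trans (by gcongr)
    _ = _ := by
        rw [hinvh, ENNReal.ofReal_inv_of_pos hh0]

end Increments

end Literature.Analysis.FunctionSpaces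

end
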